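/-
Width seat `ym-line-cbag-p1-w2` (prover-ym-line-cbag-p1-w2-g2-0; own items 22254/22893 closed), route `ColdBoxAllGroups`, helping crux
`BulkAllGroups` (stmt-QuantumFields-22255), line `dlr-chessboard-G` (lead `ym-line-cbag-p2`): SMALL PLAQUETTES + SMALL EXTERIOR DATUM ⇒
SMALL LINKS and SMALL CHART COORDINATES, every compact group presented in `U(N)` — the vocabulary-free half of the G-port of
`…ColdBoxTiltBoundDatum` §1 (R1 with datum), in the Frobenius length of the BOX line's «LinkSmallG».
-/
import Summits.QuantumFields.YangMills.Theorems.ColdBoxAllGroupsBoxFloorAllGroupsLinkSmallG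
import Summits.QuantumFields.YangMills.Theorems.ColdBoxAllGroupsOneScaleDefs
import Summits.QuantumFields.YangMills.Theorems.WeakCouplingRatesBulkDominatesColdBoxWForestPoincareDatum

/-!
# Crux `BulkAllGroups` (stmt-QuantumFields-22255), stubs N2-cov-G / N2-mean-G: small plaquettes + small exterior datum ⇒ small links
# and small chart coordinates (R1 with datum, any compact `G`)

The datum twin of `Theorems/ColdBoxAllGroupsBoxFloorAllGroupsLinkSmallG.lean` (R1 of the flat one-scale expansion), i.e. the G-port of
`WeakCouplingRates.ell_hol_le_of_cost_le_of_exterior_le` / `su2_opDist1_le_of_cost_le_of_exterior_le` / `sum_sq_extDatum_le_of_plaqCost_le`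
(`…ColdBoxTiltBoundDatum` §1), stated WITHOUT the datum chart vocabulary (`cfgTD`, `goodTD`, … — those belong to the lead's datum-objects file):
the configuration is any `V : ℤ⁴ → G`, resp. any family of chart coordinates `a : edges → ℝ^D` with `V e = expChart ρ (a e)`.  Length function
`ℓ(g) = ‖ρ(g) − 1‖_F` (`ℓ² = 2·cost`, `frobDist_le_of_cost_le`; subadditive, inversion and CONJUGATION invariant — `frobDist_conj`, Frobenius
unitary invariance), fed to the G-free Poincaré ladder with small exterior `ell_le_uniform_of_exterior_le` (`…ForestPoincareDatum`).

* `frobDist_hol_le_of_plaqCost_le_of_exterior_le` — exterior links (off `Λ = boxEdges 4 (2H+1)`) with `ℓ ≤ r`, touching plaquettes with cost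
  `N − Re tr ρ(V_p) ≤ δ²` ⇒ EVERY plaquette holonomy of `ℤ⁴` has `ℓ ≤ √2·δ + 4r` (plaquettes off the box are products of four exterior links);
* **`frobDist_link_le_of_plaqCost_le_of_exterior_le`** — … and forest links `1`, `H ≥ 1` ⇒ EVERY link has `ℓ(V_e) ≤ (12H²+2H+1)(√2·δ + 8r)`;
* `frobDist_expChart_le`, `cost_expChart_le` — an exterior chart point `expChart ρ a` has `ℓ ≤ ‖a‖` and cost `≤ ‖a‖²/2`;
* **`norm_chart_le_of_plaqCost_le_of_exterior_le`** (R1 with datum) — if `V e = expChart ρ (a e)` for all `e`, with `‖a e‖ ≤ 1/16` a priori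
  (the chart window of the one-scale integration), `‖a e‖ ≤ r` off `Λ`, `a = 0` on the temporal forest, and every plaquette touching `Λ` costs
  `≤ δ²`, then EVERY chart coordinate has `‖a e‖ ≤ 2(12H²+2H+1)(√2·δ + 8r)` (inverse Lipschitz bound `norm_le_two_mul_frobDist_expChart`); `_lt`
  version for the strict inequalities of the small-field event.  With `a = extDatum ϑᵀ ((t + μ)/√β)` this is the sup-norm input `m` of the cubic
  chart remainder «CubicG» `abs_cost_expChart_holonomy_sub_half_norm_sq_le` per plaquette (R3 with datum) and of the Jacobian term of the tilt (T4).
No sorry; no definition; standard axioms.  NOT a claim about the mass gap: rung-level support (R2xi-G `XiPow`, RECORD label); the Yang–Mills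
mass gap is NOT proved by any of this.
-/

set_option autoImplicit false

noncomputable section

open Finset
open scoped Matrix.Norms.Frobenius
open Literature.Probability.LatticeModels (Site)
open Literature.MathematicalPhysics.QuantumLattice
open Literature.MathematicalPhysics.QuantumFieldTheory
open Literature.MathematicalPhysics.QuantumFieldTheory.AxialGauge

namespace Summit.QuantumFields.YangMills.Theorems.ColdBoxAllGroups

open Summit.QuantumFields.YangMills.Theorems.WeakCouplingRates
open Summit.QuantumFields.YangMills.Theorems.EquipartitionPinsProbe
open Summit.QuantumFields.YangMills.Theorems.FreeEnergyLogCoefficient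

variable {N : ℕ} {G : Type} [Group G] (ρ : G →* Matrix (Fin N) (Fin N) ℂ)
  (hρu : ∀ g, ρ g ∈ Matrix.unitaryGroup (Fin N) ℂ) {H : ℕ}

/-! ## Conjugation invariance of the Frobenius length -/

include hρu in
/-- `ℓ(x g x⁻¹) = ℓ(g)` for `ℓ(g) = ‖ρ(g) − 1‖_F` (Frobenius unitary invariance on both sides). -/
theorem frobDist_conj (x g : G) : ‖ρ (x * g * x⁻¹) - 1‖ = ‖ρ g - 1‖ := by
  have hx : ρ x ∈ Matrix.unitaryGroup (Fin N) ℂ := hρu x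
  have hxinv : ρ x⁻¹ ∈ Matrix.unitaryGroup (Fin N) ℂ := hρu x⁻¹
  have hprod : ρ x * ρ x⁻¹ = 1 := by rw [← map_mul, mul_inv_cancel, map_one]
  have hrw : ρ (x * g * x⁻¹) - 1 = ρ x * (ρ g - 1) * ρ x⁻¹ := by
    rw [map_mul, map_mul, mul_sub, sub_mul, mul_one, hprod]
  rw [hrw, Matrix.frobenius_norm_mul_unitaryGroup _ ⟨ρ x⁻¹, hxinv⟩,
    Matrix.frobenius_norm_unitaryGroup_mul ⟨ρ x, hx⟩]

/-! ## Small plaquettes + small exterior ⇒ small holonomies and small links -/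

include hρu in
/-- **Every plaquette holonomy is `ℓ`-small with a small exterior**: if every exterior link of `V` (off the cold box) has
`‖ρ(V_e) − 1‖_F ≤ r` and every plaquette touching the box costs `≤ δ²`, then every plaquette holonomy of `ℤ⁴` (all `x i j`) has
`‖ρ(V_p) − 1‖_F ≤ √2·δ + 4r` (plaquettes off the box are products of four exterior links; degenerate ones are `1`; reversed ones are inverses). -/
theorem frobDist_hol_le_of_plaqCost_le_of_exterior_le (V : LGConfig 4 G) {r δ : ℝ} (hr : 0 ≤ r) (hδ : 0 ≤ δ)
    (hout : ∀ e, e ∉ boxEdges 4 (2 * H + 1) → ‖ρ (V e) - 1‖ ≤ r)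
    (hcost : ∀ p ∈ plaquettesTouching (boxEdges 4 (2 * H + 1)), plaqCostAt ρ p.1 p.2.1.1 p.2.1.2 V ≤ δ ^ 2)
    (x : Site 4) (i j : Fin 4) : ‖ρ (plaquetteHolonomyZd V x i j) - 1‖ ≤ Real.sqrt 2 * δ + 4 * r := by
  have hδ' : 0 ≤ Real.sqrt 2 * δ := by positivity
  -- the case `i < j`
  have hlt : ∀ i j : Fin 4, i < j → ‖ρ (plaquetteHolonomyZd V x i j) - 1‖ ≤ Real.sqrt 2 * δ + 4 * r := by
    intro i j hij
    by_cases hp : ((x, ⟨(i, j), hij⟩) : ZdPlaquette 4) ∈ plaquettesTouching (boxEdges 4 (2 * H + 1))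
    · have h := hcost _ hp
      rw [plaqCostAt_eq_sub_trace] at h
      have := frobDist_le_of_cost_le ρ hρu hδ h
      simp only at this
      linarith [mul_nonneg (by norm_num : (0 : ℝ) ≤ 4) hr]
    · -- all four edges are exterior
      rw [mem_plaquettesTouching_iff, Finset.not_nonempty_iff_eq_empty] at hp
      have hnot : ∀ e ∈ plaquetteEdges ((x, ⟨(i, j), hij⟩) : ZdPlaquette 4), e ∉ boxEdges 4 (2 * H + 1) := fun e he hmem => by
        have : e ∈ plaquetteEdges ((x, ⟨(i, j), hij⟩) : ZdPlaquette 4) ∩ boxEdges 4 (2 * H + 1) := Finset.mem_inter.2 ⟨he, hmem⟩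
        rw [hp] at this; simp at this
      have h1 := hout _ (hnot (x, i) (by simp [plaquetteEdges]))
      have h2 := hout _ (hnot (x + Pi.single i 1, j) (by simp [plaquetteEdges]))
      have h3 := hout _ (hnot (x + Pi.single j 1, i) (by simp [plaquetteEdges]))
      have h4 := hout _ (hnot (x, j) (by simp [plaquetteEdges]))
      have e1 := frobDist_mul_le ρ hρu (V (x, i) * V (x + Pi.single i 1, j) * (V (x + Pi.single j 1, i))⁻¹) (V (x, j))⁻¹
      have e2 := frobDist_mul_le ρ hρu (V (x, i) * V (x + Pi.single i 1, j)) (V (x + Pi.single j 1, i))⁻¹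
      have e3 := frobDist_mul_le ρ hρu (V (x, i)) (V (x + Pi.single i 1, j))
      rw [frobDist_inv ρ hρu] at e1 e2
      rw [plaquetteHolonomyZd]
      linarith
  rcases lt_trichotomy i j with hij | rfl | hji
  · exact hlt i j hij
  · have : plaquetteHolonomyZd V x i i = 1 := by simp [plaquetteHolonomyZd]
    rw [this, map_one, sub_self, norm_zero]
    positivity
  · rw [plaquetteHolonomyZd_swap, frobDist_inv ρ hρu]
    exact hlt j i hji

include hρu in
/-- **Small plaquettes + small exterior ⇒ small links, every compact group presented in `U(N)`**: exterior links with `ℓ ≤ r`, forest links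
`1`, touching plaquettes `≤ δ²` (`r, δ ≥ 0`, `H ≥ 1`) ⇒ EVERY link has `‖ρ(V_e) − 1‖_F ≤ (12H²+2H+1)·(√2·δ + 8r)` (the G-free Poincaré ladder with
small exterior `ell_le_uniform_of_exterior_le` for the Frobenius length, at `M = √2·δ + 4r`). -/
theorem frobDist_link_le_of_plaqCost_le_of_exterior_le (hH : 1 ≤ H) (V : LGConfig 4 G) {r δ : ℝ} (hr : 0 ≤ r) (hδ : 0 ≤ δ)
    (hout : ∀ e, e ∉ boxEdges 4 (2 * H + 1) → ‖ρ (V e) - 1‖ ≤ r)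
    (hforest : ∀ x : Site 4, (∀ k : Fin 4, 1 ≤ x k ∧ x k + 1 ≤ 2 * (H : ℤ)) → V (x, 0) = 1)
    (hcost : ∀ p ∈ plaquettesTouching (boxEdges 4 (2 * H + 1)), plaqCostAt ρ p.1 p.2.1.1 p.2.1.2 V ≤ δ ^ 2)
    (e : Literature.MathematicalPhysics.QuantumLattice.ZdEdge 4) :
    ‖ρ (V e) - 1‖ ≤ (12 * (H : ℝ) ^ 2 + 2 * H + 1) * (Real.sqrt 2 * δ + 8 * r) := by
  have h := ell_le_uniform_of_exterior_le (fun g : G => ‖ρ g - 1‖) (by rw [map_one, sub_self, norm_zero])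
    (frobDist_mul_le ρ hρu) (frobDist_inv ρ hρu) (fun x g => frobDist_conj ρ hρu x g)
    V hout hforest (frobDist_hol_le_of_plaqCost_le_of_exterior_le ρ hρu V hr hδ hout hcost) hH hr e
  have e1 : (12 * (H : ℝ) ^ 2 + 2 * H + 1) * (Real.sqrt 2 * δ + 4 * r + 4 * r) =
      (12 * (H : ℝ) ^ 2 + 2 * H + 1) * (Real.sqrt 2 * δ + 8 * r) := by ring
  rw [← e1]; exact h

include hρu in
/-- **Link costs with a small exterior**: under the same hypotheses every link costs `N − Re tr ρ(V_e) ≤ (12H²+2H+1)²(√2·δ + 8r)²/2`. -/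
theorem linkCost_le_of_plaqCost_le_of_exterior_le (hH : 1 ≤ H) (V : LGConfig 4 G) {r δ : ℝ} (hr : 0 ≤ r) (hδ : 0 ≤ δ)
    (hout : ∀ e, e ∉ boxEdges 4 (2 * H + 1) → ‖ρ (V e) - 1‖ ≤ r)
    (hforest : ∀ x : Site 4, (∀ k : Fin 4, 1 ≤ x k ∧ x k + 1 ≤ 2 * (H : ℤ)) → V (x, 0) = 1)
    (hcost : ∀ p ∈ plaquettesTouching (boxEdges 4 (2 * H + 1)), plaqCostAt ρ p.1 p.2.1.1 p.2.1.2 V ≤ δ ^ 2)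
    (e : Literature.MathematicalPhysics.QuantumLattice.ZdEdge 4) :
    (N : ℝ) - (ρ (V e)).trace.re ≤ ((12 * (H : ℝ) ^ 2 + 2 * H + 1) * (Real.sqrt 2 * δ + 8 * r)) ^ 2 / 2 :=
  cost_le_of_frobDist_le ρ hρu (frobDist_link_le_of_plaqCost_le_of_exterior_le ρ hρu hH V hr hδ hout hforest hcost e)

/-! ## Chart points: a small exterior datum in the exponential chart -/

section Chart

variable [TopologicalSpace G] [CompactSpace G]

/-- **An exterior chart point is `ℓ`-close to `1`**: `‖ρ(expChart ρ a) − 1‖_F ≤ ‖a‖` (the chart is `1`-Lipschitz in the Frobenius norm). -/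
theorem frobDist_expChart_le (hρ : Continuous ρ) (hinj : Function.Injective ρ) {a : EuclideanSpace ℝ (Fin (dimE ρ))} {r : ℝ}
    (ha : ‖a‖ ≤ r) : ‖ρ (expChart ρ a) - 1‖ ≤ r :=
  (norm_rho_expChart_sub_one_le ρ hρ hinj a).trans ha

include hρu in
/-- **An exterior chart point has small cost**: `N − Re tr ρ(expChart ρ a) ≤ r²/2` for `‖a‖ ≤ r`. -/
theorem cost_expChart_le (hρ : Continuous ρ) (hinj : Function.Injective ρ) {a : EuclideanSpace ℝ (Fin (dimE ρ))} {r : ℝ}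
    (ha : ‖a‖ ≤ r) : (N : ℝ) - (ρ (expChart ρ a)).trace.re ≤ r ^ 2 / 2 :=
  cost_le_of_frobDist_le ρ hρu (frobDist_expChart_le ρ hρ hinj ha)

include hρu in
/-- **R1 with datum — the sup-norm chart-coordinate bound with a small exterior datum, every compact group presented in `U(N)`.**  Let the links
of `V` be chart points `V e = expChart ρ (a e)` with `‖a e‖ ≤ 1/16` (a priori: the chart window of the one-scale integration), let the exterior
coordinates be small, `‖a e‖ ≤ r` for `e ∉ Λ = boxEdges 4 (2H+1)`, let `a = 0` on the temporal forest, and let every plaquette touching `Λ`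
cost `≤ δ²` (`r, δ ≥ 0`, `H ≥ 1`).  Then EVERY chart coordinate (free, forest and exterior alike) has `‖a e‖ ≤ 2·(12H²+2H+1)·(√2·δ + 8r)`. -/
theorem norm_chart_le_of_plaqCost_le_of_exterior_le (hρ : Continuous ρ) (hinj : Function.Injective ρ) (hH : 1 ≤ H)
    (a : Literature.MathematicalPhysics.QuantumLattice.ZdEdge 4 → EuclideanSpace ℝ (Fin (dimE ρ))) {r δ : ℝ} (hr : 0 ≤ r) (hδ : 0 ≤ δ)
    (ha : ∀ e, ‖a e‖ ≤ 1 / 16)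
    (hout : ∀ e, e ∉ boxEdges 4 (2 * H + 1) → ‖a e‖ ≤ r)
    (hforest : ∀ x : Site 4, (∀ k : Fin 4, 1 ≤ x k ∧ x k + 1 ≤ 2 * (H : ℤ)) → a (x, 0) = 0)
    (hcost : ∀ p ∈ plaquettesTouching (boxEdges 4 (2 * H + 1)),
      plaqCostAt ρ p.1 p.2.1.1 p.2.1.2 (fun e => expChart ρ (a e)) ≤ δ ^ 2)
    (e : Literature.MathematicalPhysics.QuantumLattice.ZdEdge 4) :
    ‖a e‖ ≤ 2 * ((12 * (H : ℝ) ^ 2 + 2 * H + 1) * (Real.sqrt 2 * δ + 8 * r)) := by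
  set V : LGConfig 4 G := fun e => expChart ρ (a e) with hV
  have houtV : ∀ e, e ∉ boxEdges 4 (2 * H + 1) → ‖ρ (V e) - 1‖ ≤ r := fun e he =>
    frobDist_expChart_le ρ hρ hinj (hout e he)
  have hforestV : ∀ x : Site 4, (∀ k : Fin 4, 1 ≤ x k ∧ x k + 1 ≤ 2 * (H : ℤ)) → V (x, 0) = 1 := fun x hx => by
    show expChart ρ (a (x, 0)) = 1
    rw [hforest x hx, expChart_zero ρ hρ hinj]
  have h := frobDist_link_le_of_plaqCost_le_of_exterior_le ρ hρu hH V hr hδ houtV hforestV hcost e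
  exact (norm_le_two_mul_frobDist_expChart ρ hρ hinj (ha e)).trans (by linarith)

include hρu in
/-- The same bound from STRICT plaquette-cost inequalities `< δ²` (the form of the small-field event `coldGoodSetG`). -/
theorem norm_chart_le_of_plaqCost_lt_of_exterior_le (hρ : Continuous ρ) (hinj : Function.Injective ρ) (hH : 1 ≤ H)
    (a : Literature.MathematicalPhysics.QuantumLattice.ZdEdge 4 → EuclideanSpace ℝ (Fin (dimE ρ))) {r δ : ℝ} (hr : 0 ≤ r) (hδ : 0 ≤ δ)
    (ha : ∀ e, ‖a e‖ ≤ 1 / 16)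
    (hout : ∀ e, e ∉ boxEdges 4 (2 * H + 1) → ‖a e‖ ≤ r)
    (hforest : ∀ x : Site 4, (∀ k : Fin 4, 1 ≤ x k ∧ x k + 1 ≤ 2 * (H : ℤ)) → a (x, 0) = 0)
    (hcost : ∀ p ∈ plaquettesTouching (boxEdges 4 (2 * H + 1)),
      plaqCostAt ρ p.1 p.2.1.1 p.2.1.2 (fun e => expChart ρ (a e)) < δ ^ 2)
    (e : Literature.MathematicalPhysics.QuantumLattice.ZdEdge 4) :
    ‖a e‖ ≤ 2 * ((12 * (H : ℝ) ^ 2 + 2 * H + 1) * (Real.sqrt 2 * δ + 8 * r)) :=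
  norm_chart_le_of_plaqCost_le_of_exterior_le ρ hρu hρ hinj hH a hr hδ ha hout hforest (fun p hp => (hcost p hp).le) e

include hρu in
/-- **R1 with datum on the small-field event**: the same with the plaquette costs read from membership of the chart configuration in
`coldGoodSetG ρ H β ε` (`δ² = β^{2ε−1}`): every chart coordinate has `‖a e‖ ≤ 2·(12H²+2H+1)·(√2·√(β^{2ε−1}) + 8r)`. -/
theorem norm_chart_le_of_mem_coldGoodSetG_of_exterior_le (hρ : Continuous ρ) (hinj : Function.Injective ρ) (hH : 1 ≤ H) {β ε : ℝ}
    (hβ : 0 < β) (a : Literature.MathematicalPhysics.QuantumLattice.ZdEdge 4 → EuclideanSpace ℝ (Fin (dimE ρ))) {r : ℝ} (hr : 0 ≤ r)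
    (ha : ∀ e, ‖a e‖ ≤ 1 / 16)
    (hout : ∀ e, e ∉ boxEdges 4 (2 * H + 1) → ‖a e‖ ≤ r)
    (hforest : ∀ x : Site 4, (∀ k : Fin 4, 1 ≤ x k ∧ x k + 1 ≤ 2 * (H : ℤ)) → a (x, 0) = 0)
    (hgood : (fun e => expChart ρ (a e)) ∈ coldGoodSetG ρ H β ε)
    (e : Literature.MathematicalPhysics.QuantumLattice.ZdEdge 4) :
    ‖a e‖ ≤ 2 * ((12 * (H : ℝ) ^ 2 + 2 * H + 1) * (Real.sqrt 2 * Real.sqrt (β ^ (2 * ε - 1)) + 8 * r)) := by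
  refine norm_chart_le_of_plaqCost_lt_of_exterior_le ρ hρu hρ hinj hH a hr (Real.sqrt_nonneg _) ha hout hforest ?_ e
  intro p hp
  rw [Real.sq_sqrt (Real.rpow_nonneg hβ.le _)]
  exact (mem_coldGoodSetG_iff ρ β ε _).1 hgood p hp

end Chart

end Summit.QuantumFields.YangMills.Theorems.ColdBoxAllGroups

end
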